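import Summits.KontsevichZagierPeriods.KontsevichZagierPeriods.Theorems.GammaHodgeSector.Negative.Canonical
import Literature.NumberTheory.Transcendental.KZIntervalPeriodProofs

/-!
# `RationalGaugeTransport` (crux-idea card `weil-principle-b-transport`, SketchIdeator4) is FALSE as typed

Crux triage r2, triager 2 (refuter-cruxtri-stmt-KontsevichZagierPeriods-3742-r2-2-0), crux
stmt-KontsevichZagierPeriods-3742 `GammaHodgeSector`.

The card's "engine" `SketchIdeator4.RationalGaugeTransport` (stated "provable now from KZStokesBox")
asserts: a divergence certificate `∂ₛ(F/R) = Σᵢ ∂ᵢ Gᵢ` on the OPEN box with `Gᵢ = 0` BY VALUE on the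
faces makes the two gauged end fibres KZ-equivalent.  It forgets that `Gᵢ` must be continuous up to
the faces (box-Stokes needs LIMITS), that `F` must be continuous up to the end parameters, and that
`∂ₛ(F/R)` must be integrable on the slab — the three hypotheses its sibling
`SketchIdeator5.LiouvilleDeterminantTransport` does carry.  Witness (n = 0, box (0,1), s ∈ [0,1]):
`F s x = s`, `R = 1`, `G s x = x − ½` inside the box and `0` on the faces; every hypothesis holds and the
conclusion would equate `[(0,1), 0]` with `[(0,1), 1]` (values `0 ≠ B(1,1)`), contradicting soundness
(`Equivalent.value_eq_holds`).  The definition below is a VERBATIM copy of the card's (the crux file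
`Cruxes/GammaHodgeSector/SketchIdeator4.lean` is not built on the farm, so it cannot be imported).
-/

noncomputable section

set_option linter.dupNamespace false

open Set MeasureTheory Filter MvPolynomial
open scoped BigOperators Topology

namespace Summit.KontsevichZagierPeriods.KontsevichZagierPeriods.Cruxes.GammaHodgeSector.TriageR2K2

open Literature.NumberTheory.Transcendental
open Literature.NumberTheory.Transcendental.KZ
open Literature.ModelTheory.ExponentialFields (IsSemialgebraic isSemialgebraic_setOf_eval_le
  isSemialgebraic_setOf_eval_lt)
open Summit.KontsevichZagierPeriods.GammaHodgeSectorNegative (cubeRep cubeRep_value cubeDom cubeFun)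

/-- VERBATIM copy of `SketchIdeator4.RationalGaugeTransport` (card weil-principle-b-transport). -/
def RationalGaugeTransport : Prop :=
  ∀ (n : ℕ) (a b : Fin (n + 1) → ℝ) (s₀ s₁ : ℝ), (∀ i, a i < b i) → s₀ < s₁ →
    IsAlgebraic ℚ s₀ → IsAlgebraic ℚ s₁ →
  ∀ (F : ℝ → (Fin (n + 1) → ℝ) → ℝ) (dF : ℝ → (Fin (n + 1) → ℝ) → ℝ) (R dR : ℝ → ℝ)
    (G dG : Fin (n + 1) → ℝ → (Fin (n + 1) → ℝ) → ℝ),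
    IsSemialgebraicFunOn ℚ {p : Fin (n + 2) → ℝ | p 0 ∈ Set.Icc s₀ s₁ ∧
        ∀ i : Fin (n + 1), p i.succ ∈ Set.Icc (a i) (b i)} (fun p => F (p 0) (fun i => p i.succ)) →
    IsSemialgebraicFunOn ℚ {p : Fin 1 → ℝ | p 0 ∈ Set.Icc s₀ s₁} (fun p => R (p 0)) →
    (∀ i, IsSemialgebraicFunOn ℚ {p : Fin (n + 2) → ℝ | p 0 ∈ Set.Icc s₀ s₁ ∧
        ∀ i : Fin (n + 1), p i.succ ∈ Set.Icc (a i) (b i)} (fun p => G i (p 0) (fun i => p i.succ))) →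
    (∀ s ∈ Set.Icc s₀ s₁, R s ≠ 0) →
    (∀ s ∈ Set.Ioo s₀ s₁, HasDerivAt R (dR s) s) →
    (∀ s ∈ Set.Ioo s₀ s₁, ∀ x, (∀ i, x i ∈ Set.Ioo (a i) (b i)) →
        HasDerivAt (fun σ => F σ x) (dF s x) s ∧
        (∀ i, HasDerivAt (fun ξ => G i s (Function.update x i ξ)) (dG i s x) (x i)) ∧
        (dF s x * R s - F s x * dR s) / (R s) ^ 2 = ∑ i, dG i s x) →
    (∀ i, ∀ s ∈ Set.Icc s₀ s₁, ∀ x, (∀ j, x j ∈ Set.Icc (a j) (b j)) →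
        (x i = a i ∨ x i = b i) → G i s x = 0) →
    ∀ (r₀ r₁ : KZ.IntegralRep (n + 1)),
      r₀.domain = {x | ∀ i, x i ∈ Set.Ioo (a i) (b i)} →
      Set.EqOn r₀.integrand (fun x => F s₀ x / R s₀) r₀.domain →
      r₁.domain = {x | ∀ i, x i ∈ Set.Ioo (a i) (b i)} →
      Set.EqOn r₁.integrand (fun x => F s₁ x / R s₁) r₁.domain →
      KZ.Equivalent r₀ r₁

/-! ## The witness -/

/-- family of integrands `F s x = s`. -/
def Fw : ℝ → (Fin 1 → ℝ) → ℝ := fun s _ => s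
/-- its `s`-derivative. -/
def dFw : ℝ → (Fin 1 → ℝ) → ℝ := fun _ _ => 1
/-- trivial gauge. -/
def Rw : ℝ → ℝ := fun _ => 1
/-- its derivative. -/
def dRw : ℝ → ℝ := fun _ => 0
/-- the DISCONTINUOUS certificate: `x − ½` inside the box, `0` on the faces. -/
def Gw : Fin 1 → ℝ → (Fin 1 → ℝ) → ℝ := fun _ _ x => if x 0 ∈ Ioo (0:ℝ) 1 then x 0 - 1 / 2 else 0
/-- its `x`-derivative inside the box. -/
def dGw : Fin 1 → ℝ → (Fin 1 → ℝ) → ℝ := fun _ _ _ => 1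
/-- box corners. -/
def aw : Fin 1 → ℝ := fun _ => 0
/-- box corners. -/
def bw : Fin 1 → ℝ := fun _ => 1

/-- the closed slab `[0,1] × [0,1]` in the card's spelling. -/
def slab : Set (Fin 2 → ℝ) :=
  {p : Fin 2 → ℝ | p 0 ∈ Icc (0:ℝ) 1 ∧ ∀ i : Fin 1, p i.succ ∈ Icc (aw i) (bw i)}

theorem slab_eq : slab = (({p : Fin 2 → ℝ | 0 ≤ p 0} ∩ {p | p 0 ≤ 1}) ∩ {p | 0 ≤ p 1}) ∩ {p | p 1 ≤ 1} := by
  ext p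
  simp [slab, aw, bw, Fin.forall_fin_one, and_assoc]

theorem isSemialgebraic_slab : IsSemialgebraic ℚ slab := by
  have h1 := isSemialgebraic_setOf_eval_le (k := ℚ) (R := ℝ) (0 : MvPolynomial (Fin 2) ℚ) (X 0)
  have h2 := isSemialgebraic_setOf_eval_le (k := ℚ) (R := ℝ) (X 0 : MvPolynomial (Fin 2) ℚ) 1
  have h3 := isSemialgebraic_setOf_eval_le (k := ℚ) (R := ℝ) (0 : MvPolynomial (Fin 2) ℚ) (X 1)
  have h4 := isSemialgebraic_setOf_eval_le (k := ℚ) (R := ℝ) (X 1 : MvPolynomial (Fin 2) ℚ) 1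
  simp only [map_zero, aeval_X, map_one] at h1 h2 h3 h4
  rw [slab_eq]
  exact ((h1.inter h2).inter h3).inter h4

theorem seg_eq : {p : Fin 1 → ℝ | p 0 ∈ Icc (0:ℝ) 1} = {p : Fin 1 → ℝ | 0 ≤ p 0} ∩ {p | p 0 ≤ 1} := by
  ext p
  simp

theorem isSemialgebraic_seg : IsSemialgebraic ℚ {p : Fin 1 → ℝ | p 0 ∈ Icc (0:ℝ) 1} := by
  have h1 := isSemialgebraic_setOf_eval_le (k := ℚ) (R := ℝ) (0 : MvPolynomial (Fin 1) ℚ) (X 0)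
  have h2 := isSemialgebraic_setOf_eval_le (k := ℚ) (R := ℝ) (X 0 : MvPolynomial (Fin 1) ℚ) 1
  simp only [map_zero, aeval_X, map_one] at h1 h2
  rw [seg_eq]
  exact h1.inter h2

theorem inside_eq : {p : Fin 2 → ℝ | p 1 ∈ Ioo (0:ℝ) 1} = {p : Fin 2 → ℝ | 0 < p 1} ∩ {p | p 1 < 1} := by
  ext p
  simp

theorem isSemialgebraic_inside : IsSemialgebraic ℚ {p : Fin 2 → ℝ | p 1 ∈ Ioo (0:ℝ) 1} := by
  have h1 := isSemialgebraic_setOf_eval_lt (k := ℚ) (R := ℝ) (0 : MvPolynomial (Fin 2) ℚ) (X 1)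
  have h2 := isSemialgebraic_setOf_eval_lt (k := ℚ) (R := ℝ) (X 1 : MvPolynomial (Fin 2) ℚ) 1
  simp only [map_zero, aeval_X, map_one] at h1 h2
  rw [inside_eq]
  exact h1.inter h2

/-- The glued certificate is `ℚ`-semialgebraic on the closed slab (graph = union of two graphs). -/
theorem isSemialgebraicFunOn_Gw (i : Fin 1) :
    IsSemialgebraicFunOn ℚ slab (fun p => Gw i (p 0) (fun j => p j.succ)) := by
  set P : Set (Fin 2 → ℝ) := {p | p 1 ∈ Ioo (0:ℝ) 1} with hP
  have hA : IsSemialgebraic ℚ (slab ∩ P) := isSemialgebraic_slab.inter isSemialgebraic_inside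
  have hB : IsSemialgebraic ℚ (slab ∩ Pᶜ) := isSemialgebraic_slab.inter isSemialgebraic_inside.compl
  have hf : IsSemialgebraicFunOn ℚ (slab ∩ P)
      (fun p => aeval p (X 1 - C (1 / 2) : MvPolynomial (Fin 2) ℚ)) :=
    isSemialgebraicFunOn_aeval hA _
  have hg : IsSemialgebraicFunOn ℚ (slab ∩ Pᶜ) (fun p => aeval p (0 : MvPolynomial (Fin 2) ℚ)) :=
    isSemialgebraicFunOn_aeval hB _
  have hst : slab = (slab ∩ P) ∪ (slab ∩ Pᶜ) := (inter_union_compl slab P).symm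
  rw [hst]
  refine hf.union hg (fun p hp => ?_) (fun p hp => ?_)
  · have h1 : p 1 ∈ Ioo (0:ℝ) 1 := hp.2
    simp [Gw, h1]
  · have h1 : p 1 ∉ Ioo (0:ℝ) 1 := hp.2
    simp [Gw, h1]

/-- **`RationalGaugeTransport` is false.** -/
theorem not_rationalGaugeTransport : ¬ RationalGaugeTransport := by
  intro h
  -- the two end representations
  obtain ⟨r₀, hd₀, hi₀⟩ := exists_zeroRep (isSemialgebraic_box 1)
  have hpos : ∀ j : Fin 1, (0:ℚ) < (fun _ => (1:ℚ)) j ∧ (0:ℚ) < (fun _ => (1:ℚ)) j :=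
    fun _ => ⟨one_pos, one_pos⟩
  let r₁ : IntegralRep 1 := cubeRep (fun _ => (1:ℚ)) (fun _ => (1:ℚ)) hpos
  have hE : Equivalent r₀ r₁ := by
    refine h 0 aw bw 0 1 (fun i => by norm_num [aw, bw]) zero_lt_one isAlgebraic_zero isAlgebraic_one
      Fw dFw Rw dRw Gw dGw ?_ ?_ isSemialgebraicFunOn_Gw (fun s _ => one_ne_zero)
      (fun s _ => hasDerivAt_const s 1) (fun s _ x hx => ⟨hasDerivAt_id s, fun i => ?_, ?_⟩)
      (fun i s _ x _ hxi => ?_) r₀ r₁ ?_ ?_ rfl ?_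
    · -- F semialgebraic
      exact (isSemialgebraicFunOn_apply isSemialgebraic_slab 0).congr fun p _ => rfl
    · -- R semialgebraic
      exact (isSemialgebraicFunOn_aeval isSemialgebraic_seg (1 : MvPolynomial (Fin 1) ℚ)).congr
        fun p _ => by simp [Rw]
    · -- x-derivative of G inside the box
      obtain rfl : i = 0 := Fin.fin_one_eq_zero i
      have hx0 : x 0 ∈ Ioo (0:ℝ) 1 := by simpa [aw, bw] using hx 0
      have hev : (fun ξ : ℝ => Gw 0 s (Function.update x 0 ξ)) =ᶠ[𝓝 (x 0)] fun ξ => ξ - 1 / 2 := by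
        filter_upwards [Ioo_mem_nhds hx0.1 hx0.2] with ξ hξ
        simp [Gw, hξ]
      exact ((hasDerivAt_id (x 0)).sub_const (1 / 2)).congr_of_eventuallyEq hev
    · -- the divergence certificate
      simp [dFw, Rw, Fw, dRw, dGw]
    · -- face condition (by VALUE)
      obtain rfl : i = 0 := Fin.fin_one_eq_zero i
      simp only [aw, bw] at hxi
      rcases hxi with hxi | hxi <;> simp [Gw, hxi]
    · -- r₀ domain
      rw [hd₀]; rfl
    · -- r₀ integrand
      intro x _
      simp [hi₀, Fw, Rw]
    · -- r₁ integrand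
      intro t _
      show cubeFun (fun _ => (1:ℚ)) (fun _ => (1:ℚ)) t = Fw 1 t / Rw 1
      simp [cubeFun, Fw, Rw]
  have hv := Equivalent.value_eq_holds hE
  have h0 : r₀.value = 0 := by simp [IntegralRep.value, hi₀]
  have h1 : r₁.value = ProbabilityTheory.beta 1 1 := by
    show (cubeRep (fun _ => (1:ℚ)) (fun _ => (1:ℚ)) hpos).value = _
    rw [cubeRep_value]
    simp
  have hb : 0 < ProbabilityTheory.beta 1 1 := ProbabilityTheory.beta_pos one_pos one_pos
  rw [h0, h1] at hv
  exact absurd hv hb.ne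

/-! ## The companion "dictionary" of the same card is a ring tautology -/

/-- VERBATIM copy of `SketchIdeator4.hodgeIndicator`. -/
def hodgeIndicator (u : ℕ) (x y : ℚ) : ℚ :=
  Int.fract ((u:ℚ) * x) + Int.fract ((u:ℚ) * y) - Int.fract ((u:ℚ) * (x + y))

/-- VERBATIM copy of `SketchIdeator4.WeilSignatureDictionary`. -/
def WeilSignatureDictionary : Prop :=
  ∀ (N N' k : ℕ) (x y : Fin N → ℚ) (x' y' : Fin N' → ℚ),
    (∀ j, 0 < x j ∧ 0 < y j ∧ Int.fract (x j) ≠ 0 ∧ Int.fract (y j) ≠ 0 ∧ Int.fract (x j + y j) ≠ 0) →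
    (∀ l, 0 < x' l ∧ 0 < y' l ∧ Int.fract (x' l) ≠ 0 ∧ Int.fract (y' l) ≠ 0 ∧ Int.fract (x' l + y' l) ≠ 0) →
    ∀ u : ℕ, 0 < u → (∀ j, Nat.Coprime u (x j).den ∧ Nat.Coprime u (y j).den) →
      (∀ l, Nat.Coprime u (x' l).den ∧ Nat.Coprime u (y' l).den) →
      (((∑ j, hodgeIndicator u (x j) (y j)) - ∑ l, hodgeIndicator u (x' l) (y' l) = (k : ℚ)) ↔
       ((∑ j, hodgeIndicator u (x j) (y j)) + ∑ l, (1 - hodgeIndicator u (x' l) (y' l)) = (k : ℚ) + N'))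

/-- `WeilSignatureDictionary` holds for the trivial reason `Σ_l (1 − h′_l) = N′ − Σ_l h′_l`: it uses
none of its hypotheses and carries no information about Hodge tests or signatures. -/
theorem weilSignatureDictionary_trivial : WeilSignatureDictionary := by
  intro N N' k x y x' y' _ _ u _ _ _
  rw [Finset.sum_sub_distrib, Finset.sum_const, Finset.card_univ, Fintype.card_fin, nsmul_eq_mul,
    mul_one]
  constructor <;> intro h <;> linarith


end Summit.KontsevichZagierPeriods.KontsevichZagierPeriods.Cruxes.GammaHodgeSector.TriageR2K2
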